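import Mathlib
import Summits.ResolutionOfSingularities.ResolutionOfSingularities.Theorems.WeightedInvariantLocalWeightedDropNCResRegimePresentedAssemblyB
import Summits.ResolutionOfSingularities.ResolutionOfSingularities.Theorems.WeightedInvariantLocalWeightedDropTOT2BridgePresByStepPosB

/-!
# `WeightedInvariant.LocalWeightedDrop` ENGINE, W′|₄ line — D₃ᴮ object (17): REGIME (P) IN B-FORM FROM ITS PIECES, FROM `o ≥ 1` (hand D)

Sub-problem `ResolutionOfSingularities`, ENGINE crux `stmt-ResolutionOfSingularities-8899` (`LocalWeightedDrop`), registered stub W′|₄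
`stub_wildWideApexFourStartsWon`; res-L1-w43-plan-1 RULING 2026-08-27T21:45:42Z (D₃ᴮ lane), hand D (the `o = 1` phase).  [OURS · L1 W4.3 · chain w43 ·
res-L1-w43-lead-1 g6; def-free; the proof of `regimePresentedB_of_pieces` (…NCResRegimePresentedAssemblyB) VERBATIM with: the order hypothesis weakened to
`1 ≤ o ∧ 2 ≤ c`, the entry restricted to a NON-EMPTY HISTORY, the exit reading taking `2 ≤ c`, and the budget context (res-type-088's `2 ≤ o` form, unchanged
so that `stub_conflictBudget` applies verbatim) manufactured by the TWIN `presContext_of_presBy₁` (…TOT2BridgePresByStepPosB).  Nothing here is a statement of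
any manuscript; AI-produced, gate-checked, weaker than expert review.]

* **`regimePresentedB_of_pieces₁`** — regime (P) in B-form from `o ≥ 1`, `c ≥ 2`, non-empty history, from its pieces.
-/

set_option linter.dupNamespace false -- mandated namespace of this single-conjunct summit

noncomputable section

namespace Summit.ResolutionOfSingularities.ResolutionOfSingularities.Theorems

namespace TameFourTupleDrop

open MvPowerSeries Literature.AlgebraicGeometry.Resolution PolyDescent

variable {k : Type} [Field k]

/-- **REGIME (P), B-PERMISSIBLE FORM, FROM ITS PIECES, FROM `o ≥ 1`, `c ≥ 2`, NON-EMPTY HISTORY.**  As `regimePresented_of_pieces` (same pieces `ψsel/hsel/M/hM_succ/hM_conf/hP1/hPx`), with the two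
one-step pieces in B-form: (P2_B) off a conflict / (P2c_B) at a conflict, SOME B-PERMISSIBLE move has, at every answer, its TRANSFORM admissible and: of
smaller head; or of the same head and in the apex column; or of the same head and RECORDED by a well-prepared family (resp. point-family) successor label.
Conclusion: `DBWinsTo` towards «admissible, head dropped or same head in the apex column». -/
theorem regimePresentedB_of_pieces₁ [Infinite k]
    (ψsel : (d : ℕ) → (Fin d → MvPowerSeries (Fin 2) k) → MvPowerSeries (Fin 2) k)
    (hsel : ∀ (d : ℕ) (X : Fin d → MvPowerSeries (Fin 2) k), IsPosT d X → IsPrepRecentring d X (ψsel d X))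
    (M : (d : ℕ) → (Fin d → MvPowerSeries (Fin 2) k) → Finset (Fin 2) → ℕ)
    (hM_succ : ∀ (d : ℕ) (A : Fin d → MvPowerSeries (Fin 2) k) (N : Finset (Fin 2)) (A' : Fin d → MvPowerSeries (Fin 2) k)
      (N' : Finset (Fin 2)),
      (∃ (b : MvPowerSeries (Fin (2 + 1)) k) (δ : Decoration k 2) (Θ : Fin (2 + 1) → MvPowerSeries (Fin (2 + 1)) k),
        Admissible b δ ∧ 2 ≤ δ.o ∧ δ.c = d ∧ δ.PresBy d A N Θ) →
      InPoly d A → InPoly d A' → SuccFamilySel d (ψsel d) A N A' N' → M d A' N' ≤ M d A N)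
    (hM_conf : ∀ (d : ℕ) (A : Fin d → MvPowerSeries (Fin 2) k) (N : Finset (Fin 2)) (A' : Fin d → MvPowerSeries (Fin 2) k)
      (N' : Finset (Fin 2)),
      (∃ (b : MvPowerSeries (Fin (2 + 1)) k) (δ : Decoration k 2) (Θ : Fin (2 + 1) → MvPowerSeries (Fin (2 + 1)) k),
        Admissible b δ ∧ 2 ≤ δ.o ∧ δ.c = d ∧ δ.PresBy d A N Θ) →
      InPoly d A → InPoly d A' → NCPoly.Conflict d A N → PointFamilySel d (ψsel d) A N A' N' → M d A' N' < M d A N)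
    (hP1 : ∀ (b : MvPowerSeries (Fin (2 + 1)) k) (δ : Decoration k 2), Admissible b δ → 1 ≤ δ.o → ¬ δ.HCol →
      δ.O.Nonempty →
      ∃ (A : Fin δ.c → MvPowerSeries (Fin 2) k) (N : Finset (Fin 2)) (Θ : Fin (2 + 1) → MvPowerSeries (Fin (2 + 1)) k),
        δ.PresBy δ.c A N Θ ∧ InPoly δ.c A)
    (hPx : ∀ (b : MvPowerSeries (Fin (2 + 1)) k) (δ : Decoration k 2) (d : ℕ) (A : Fin d → MvPowerSeries (Fin 2) k) (N : Finset (Fin 2))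
      (Θ : Fin (2 + 1) → MvPowerSeries (Fin (2 + 1)) k),
      Admissible b δ → 1 ≤ δ.o → 2 ≤ δ.c → δ.c = d → δ.PresBy d A N Θ → WellPrepared d A → ¬ InPoly d A → δ.HCol)
    (hP2 : ∀ (b : MvPowerSeries (Fin (2 + 1)) k) (δ : Decoration k 2) (d : ℕ) (A : Fin d → MvPowerSeries (Fin 2) k) (N : Finset (Fin 2))
      (Θ : Fin (2 + 1) → MvPowerSeries (Fin (2 + 1)) k),
      Admissible b δ → 1 ≤ δ.o → δ.c = d → δ.PresBy d A N Θ → InPoly d A → ¬ NCPoly.Conflict d A N →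
      ∃ (Φ : Fin (2 + 1) → MvPowerSeries (Fin (2 + 1)) k) (w : Fin (2 + 1) → ℕ), IsBPermissible δ Φ w ∧
        BMoveClause (b, δ) Φ w (fun τ' => Admissible τ'.1 τ'.2 ∧ (τ'.2.head < δ.head ∨ (τ'.2.head = δ.head ∧ (τ'.2.HCol ∨
          ∃ (A' : Fin d → MvPowerSeries (Fin 2) k) (N' : Finset (Fin 2)) (Θ' : Fin (2 + 1) → MvPowerSeries (Fin (2 + 1)) k),
            τ'.2.PresBy d A' N' Θ' ∧ WellPrepared d A' ∧ SuccFamilySel d (ψsel d) A N A' N')))))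
    (hP2c : ∀ (b : MvPowerSeries (Fin (2 + 1)) k) (δ : Decoration k 2) (d : ℕ) (A : Fin d → MvPowerSeries (Fin 2) k) (N : Finset (Fin 2))
      (Θ : Fin (2 + 1) → MvPowerSeries (Fin (2 + 1)) k),
      Admissible b δ → 1 ≤ δ.o → δ.c = d → δ.PresBy d A N Θ → InPoly d A → NCPoly.Conflict d A N →
      ∃ (Φ : Fin (2 + 1) → MvPowerSeries (Fin (2 + 1)) k) (w : Fin (2 + 1) → ℕ), IsBPermissible δ Φ w ∧
        BMoveClause (b, δ) Φ w (fun τ' => Admissible τ'.1 τ'.2 ∧ (τ'.2.head < δ.head ∨ (τ'.2.head = δ.head ∧ (τ'.2.HCol ∨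
          ∃ (A' : Fin d → MvPowerSeries (Fin 2) k) (N' : Finset (Fin 2)) (Θ' : Fin (2 + 1) → MvPowerSeries (Fin (2 + 1)) k),
            τ'.2.PresBy d A' N' Θ' ∧ WellPrepared d A' ∧ PointFamilySel d (ψsel d) A N A' N')))))
    (b : MvPowerSeries (Fin (2 + 1)) k) (δ : Decoration k 2) (hadm : Admissible b δ) (ho : 1 ≤ δ.o) (h2 : 2 ≤ δ.c) (hnc : ¬ δ.HCol)
    (hreg : δ.O.Nonempty) :
    DBWinsTo (fun τ : MvPowerSeries (Fin (2 + 1)) k × Decoration k 2 => Admissible τ.1 τ.2 ∧ (τ.2.head < δ.head ∨ (τ.2.head = δ.head ∧ τ.2.HCol)))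
      (b, δ) := by
  classical
  set d : ℕ := δ.c with hd_def
  have hd : 0 < d := by rw [hd_def]; omega
  obtain ⟨A₀, N₀, Θ₀, hpres₀, hin₀⟩ := hP1 b δ hadm ho hnc hreg
  -- recordings: (decorated position, (label, boundary))
  let L : Type := (Fin d → MvPowerSeries (Fin 2) k) × Finset (Fin 2)
  let Q : MvPowerSeries (Fin (2 + 1)) k × Decoration k 2 → Prop := fun τ =>
    Admissible τ.1 τ.2 ∧ (τ.2.head < δ.head ∨ (τ.2.head = δ.head ∧ τ.2.HCol))
  let C : Set ((MvPowerSeries (Fin (2 + 1)) k × Decoration k 2) × L) := {σ | Admissible σ.1.1 σ.1.2 ∧ σ.1.2.head = δ.head ∧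
    (∃ Θ : Fin (2 + 1) → MvPowerSeries (Fin (2 + 1)) k, σ.1.2.PresBy d σ.2.1 σ.2.2 Θ) ∧ InPoly d σ.2.1}
  -- measure `Λ·M + polyhedron rank`
  let rk : (Fin d → MvPowerSeries (Fin 2) k) → Ordinal.{0} := fun A => ((wellFounded_polyRelSel (k := k) hd (hsel d)).apply A).rank
  let Λ : Ordinal.{0} := (⨆ A, rk A) + 1
  have hΛ : ∀ A, rk A < Λ := fun A => Order.lt_add_one_iff.mpr (le_ciSup (Ordinal.bddAbove_of_small (s := Set.range rk)) A)
  let μ : (MvPowerSeries (Fin (2 + 1)) k × Decoration k 2) × L → Ordinal.{0} := fun σ => Λ * (M d σ.2.1 σ.2.2 : Ordinal.{0}) + rk σ.2.1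
  have hlex : ∀ (n n' : ℕ) (A A' : Fin d → MvPowerSeries (Fin 2) k), n' < n ∨ (n' = n ∧ rk A' < rk A) →
      Λ * (n' : Ordinal.{0}) + rk A' < Λ * (n : Ordinal.{0}) + rk A := by
    rintro n n' A A' (hn | ⟨rfl, hr⟩)
    · have hn' : ((n' + 1 : ℕ) : Ordinal.{0}) ≤ (n : Ordinal.{0}) := Nat.cast_le.mpr (Nat.succ_le_of_lt hn)
      calc Λ * (n' : Ordinal.{0}) + rk A' < Λ * (n' : Ordinal.{0}) + Λ := by
            gcongr
            exact hΛ A'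
        _ = Λ * ((n' + 1 : ℕ) : Ordinal.{0}) := by rw [Nat.cast_succ, mul_add_one]
        _ ≤ Λ * (n : Ordinal.{0}) := by gcongr
        _ ≤ Λ * (n : Ordinal.{0}) + rk A := le_self_add
    · gcongr
  have hoc : ∀ δ' : Decoration k 2, δ'.head = δ.head → δ'.o = δ.o ∧ δ'.c = d := by
    intro δ' h
    rw [Decoration.head, Decoration.head, toLex_inj, Prod.ext_iff] at h
    exact ⟨h.1, h.2⟩
  have hσ₀ : (((b, δ), (A₀, N₀)) : (MvPowerSeries (Fin (2 + 1)) k × Decoration k 2) × L) ∈ C := ⟨hadm, rfl, ⟨Θ₀, hpres₀⟩, hin₀⟩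
  refine DBWinsTo.of_measure_labels (Q := Q) C μ ?_ hσ₀
  rintro ⟨⟨b₁, δ₁⟩, ⟨A₁, N₁⟩⟩ ⟨hadm₁, hhead₁, ⟨Θ₁, hpres₁⟩, hin₁⟩ -
  obtain ⟨ho₁, hc₁⟩ := hoc δ₁ hhead₁
  have ho₁' : 1 ≤ δ₁.o := by rw [ho₁]; exact ho
  have h2₁ : 2 ≤ δ₁.c := by rw [hc₁, hd_def]; exact h2
  have hctx : ∃ (b : MvPowerSeries (Fin (2 + 1)) k) (δ : Decoration k 2) (Θ : Fin (2 + 1) → MvPowerSeries (Fin (2 + 1)) k),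
      Admissible b δ ∧ 2 ≤ δ.o ∧ δ.c = d ∧ δ.PresBy d A₁ N₁ Θ := presContext_of_presBy₁ hadm₁ ho₁' h2₁ hc₁ hpres₁
  -- reading a presented same-head transform: continue (recorded, measure drops) or exit (apex column)
  have hread : ∀ (τ' : MvPowerSeries (Fin (2 + 1)) k × Decoration k 2), Admissible τ'.1 τ'.2 → τ'.2.head = δ.head →
      ∀ (A' : Fin d → MvPowerSeries (Fin 2) k) (N' : Finset (Fin 2)) (Θ' : Fin (2 + 1) → MvPowerSeries (Fin (2 + 1)) k),
      τ'.2.PresBy d A' N' Θ' → WellPrepared d A' →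
      (M d A' N' < M d A₁ N₁ ∨ (M d A' N' = M d A₁ N₁ ∧ rk A' < rk A₁) ∨ ¬ InPoly d A') →
      Q τ' ∨ ∃ ℓ' : L, (τ', ℓ') ∈ C ∧ μ (τ', ℓ') < μ ((b₁, δ₁), (A₁, N₁)) := by
    intro τ' hadm' hhead' A' N' Θ' hpres' hWP' halt
    obtain ⟨ho', hc'⟩ := hoc τ'.2 hhead'
    by_cases hin' : InPoly d A'
    · rcases halt with hlt | hlt | hnin
      · exact Or.inr ⟨(A', N'), ⟨hadm', hhead', ⟨Θ', hpres'⟩, hin'⟩, hlex _ _ _ _ (Or.inl hlt)⟩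
      · exact Or.inr ⟨(A', N'), ⟨hadm', hhead', ⟨Θ', hpres'⟩, hin'⟩, hlex _ _ _ _ (Or.inr hlt)⟩
      · exact absurd hin' hnin
    · have hcol' : τ'.2.HCol := hPx τ'.1 τ'.2 d A' N' Θ' hadm' (by rw [ho']; exact ho) (by rw [hc', hd_def]; exact h2) hc' hpres' hWP' hin'
      exact Or.inl ⟨hadm', Or.inr ⟨hhead', hcol'⟩⟩
  by_cases hconf : NCPoly.Conflict d A₁ N₁
  · -- point move at a conflict: the budget drops
    obtain ⟨Φ, w, hmv, hcl⟩ := hP2c b₁ δ₁ d A₁ N₁ Θ₁ hadm₁ ho₁' hc₁ hpres₁ hin₁ hconf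
    refine ⟨Φ, w, hmv, hcl.mono fun τ' hτ' => ?_⟩
    obtain ⟨hadm', hcase⟩ := hτ'
    rcases hcase with hlt | ⟨hhead', hcol' | ⟨A', N', Θ', hpres', hWP', hfam⟩⟩
    · exact Or.inl ⟨hadm', Or.inl (hhead₁ ▸ hlt)⟩
    · exact Or.inl ⟨hadm', Or.inr ⟨hhead'.trans hhead₁, hcol'⟩⟩
    · refine hread τ' hadm' (hhead'.trans hhead₁) A' N' Θ' hpres' hWP' ?_
      by_cases hin' : InPoly d A'
      · exact Or.inl (hM_conf d A₁ N₁ A' N' hctx hin₁ hin' hconf hfam)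
      · exact Or.inr (Or.inr hin')
  · -- strategy move off the conflict: budget does not rise, polyhedron rank drops
    obtain ⟨Φ, w, hmv, hcl⟩ := hP2 b₁ δ₁ d A₁ N₁ Θ₁ hadm₁ ho₁' hc₁ hpres₁ hin₁ hconf
    refine ⟨Φ, w, hmv, hcl.mono fun τ' hτ' => ?_⟩
    obtain ⟨hadm', hcase⟩ := hτ'
    rcases hcase with hlt | ⟨hhead', hcol' | ⟨A', N', Θ', hpres', hWP', hfam⟩⟩
    · exact Or.inl ⟨hadm', Or.inl (hhead₁ ▸ hlt)⟩
    · exact Or.inl ⟨hadm', Or.inr ⟨hhead'.trans hhead₁, hcol'⟩⟩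
    · refine hread τ' hadm' (hhead'.trans hhead₁) A' N' Θ' hpres' hWP' ?_
      by_cases hin' : InPoly d A'
      · have hM := hM_succ d A₁ N₁ A' N' hctx hin₁ hin' hfam
        have hrel : PolyRelSel d (ψsel d) A' A₁ := ⟨mem_succTSel_of_succFamilySel hfam, hin₁, hin'⟩
        have hrk : rk A' < rk A₁ := ((wellFounded_polyRelSel (k := k) hd (hsel d)).apply A₁).rank_lt_of_rel hrel
        rcases hM.lt_or_eq with hMlt | hMeq
        · exact Or.inl hMlt
        · exact Or.inr (Or.inl ⟨hMeq, hrk⟩)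
      · exact Or.inr (Or.inr hin')

end TameFourTupleDrop

end Summit.ResolutionOfSingularities.ResolutionOfSingularities.Theorems

end
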